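import Summits.ResolutionOfSingularities.ResolutionOfSingularities.Theorems.StallVertexOldLetter
import HarnessLib

/-!
# StallVertexLineTurn — decomp-res node «StallVertex» (lens-5 g20 rev 5), add-on tree file 12 of the node

Content VERBATIM from the decomp-res lens-5 g20 file `HOME/decomp-res-lens-5/g20/StallVertex.lean` rev 5 (pin
5d7e6b95, 3 024 l; rev 5 SUPERSEDES rev 4 74ef32c0
and rev 3 549891b7 as landing source — insertions only, all earlier statements byte-identical; HOME =
run/shared/lean/pub/decomp-res).  The rev-0/1/2 sections are
ALREADY in the tree (`StallVertexForms` / `Kernels` / `Walk` / `Classes` / `Clean` / `Rigid` / `Lines` /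
`RigidClasses` / `MaxContactCutStallVertex`, writer g7);
these add-on files carry ONLY the declarations NEW in rev 3 / rev 4 / rev 5.  Critic: CRITIC-LEDGER rows 142c (rev
3: the old-letter law, CLEARED 2026-08-30T21:45:00Z),
142d (rev 4: the general carried-line law + line dichotomy, DECIDED +1, 22:09:45Z), 142e (rev 5: the turn law,
booked toward (S), 22:25:58Z) — landing orders INBOX
:362 / :396 / :429 (2).  Landed by decomp-res writer g8 as `StallVertexCarry` (§1d–§1e), `StallVertexOldLetter`
(§1g + §3d–§3e), `StallVertexLineTurn` (§3f–§3g),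
`StallVertexLetterClasses` (§4d–§4e classes and exact re-locations) and the wiring file
`MaxContactCutStallVertexEvents` (§4f classes + every new `closes_…` /
`defectWalksDeep_iff_…` BY NAME on `MaxContactCut.DefectWalksDeep`).  All `--supports
stmt-ResolutionOfSingularities-31770`.  Every file of the node is in the
Theses cone (the lens imports the in-cone `DifferentialShade`), so the located residual is booked on the route by
RE-LOCATING the existing aside 28122
`CFNoSkewJointTailsDeep` to `StallVertex.NoStraightEventFreeSkewStalledTailsDeep` (EXACT, hypothesis-free chain skew
↔ vertexBound ↔ rigid ↔ lineFree ↔ letterFree ↔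
eventFree ↔ straight: `skew_iff_straight`) — one aside, not two (critic: «ONE aside … SUPERSEDING the rev-4
aside; nothing else»).

§3f (rev 4, `section Walk`) THE GENERAL CARRIED LINE: the line step and its collapse letters
(`single_succ_tsub_single_one`, `coeff_single_linear_pow`,
`coeff_monomial_mul_linear_pow`, `TwoOrOld`, `LineShape`, **`line_step`**, `carryLine_succ`, `third_letter`,
`exists_minimiser`, `muP_ne_top_succ`, `muP_ne_top_of_le`);
§3g (rev 5) THE TURN LAW **`turn_monomial`** (two clean moves with a chart change make the minimiser's cone a
MONOMIAL; `set_option maxHeartbeats 1600000 in`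
kept as in the lens).  PROVED, 0 sorry.  Imports `StallVertexOldLetter`.

[WRITER NOTE (decomp-res writer g8): file split only; namespace, opens, section variables and every declaration
exactly as in the lens (global `set_option` dropped; the lens's `set_option maxHeartbeats … in` on `turn_monomial` kept).]

(Sources: KawanoueMatsuki2016 Prop. 4 (2), §4.1; Hauser2010; HauserPerlega2024; Moh1987; CossartPiltant2008;
Giraud1975; Hironaka1964; ZariskiSamuelII Ch. VIII §2.)
-/

noncomputable section

open MvPolynomial Finset
open Literature.AlgebraicGeometry.Resolution
open Literature.AlgebraicGeometry.Resolution.Hauser2010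
open Literature.AlgebraicGeometry.Resolution.HauserPerlega2024
open Literature.Barriers.ResolutionOfSingularities
open Literature.AlgebraicGeometry.Resolution.PointBlowup
open Summit.ResolutionOfSingularities.ResolutionOfSingularities.Theses
open Summit.ResolutionOfSingularities.ResolutionOfSingularities.Theorems.TightDefectClasses
open Summit.ResolutionOfSingularities.ResolutionOfSingularities.Theorems.ProximityCut
open Summit.ResolutionOfSingularities.ResolutionOfSingularities.Theorems.ExitLaw
open Summit.ResolutionOfSingularities.ResolutionOfSingularities.Theorems.DifferentialShade

namespace Summit.ResolutionOfSingularities.ResolutionOfSingularities.Theorems.StallVertex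

section Walk

variable {K : Type} [Field K] [DecidableEq K]

variable {q : ℕ} {s₀ : State (Fin 3) K}

/-! ### §3f THE GENERAL CARRIED LINE: the line step and its collapse letters -/

omit [DecidableEq K] in
/-- `single_succ_tsub_single_one`: Auxiliary step of this node's calculus, VERBATIM from the lens file (see the
module docstring); the statement is its type. [folklore] -/
theorem single_succ_tsub_single_one (k : Fin 3) (γ : ℕ) :
    Finsupp.single k (γ + 1) - Finsupp.single k 1 = Finsupp.single k γ := by
  ext i; simp only [Finsupp.coe_tsub, Pi.sub_apply, Finsupp.single_apply]; split_ifs <;> omega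

omit [DecidableEq K] in
/-- The coefficient of `u_k^γ` in `(Σ cᵢuᵢ)^γ` is `c_k^γ` (every characteristic). [folklore] -/
theorem coeff_single_linear_pow (c : Fin 3 → K) (k : Fin 3) (γ : ℕ) :
    coeff (Finsupp.single k γ) ((∑ i, C (c i) * X i : MvPolynomial (Fin 3) K) ^ γ) = c k ^ γ := by
  induction γ with
  | zero => rw [pow_zero, pow_zero, Finsupp.single_zero, coeff_zero_one]
  | succ γ ih =>
    rw [pow_succ, Finset.mul_sum, coeff_sum, Finset.sum_eq_single k]
    · rw [mul_left_comm, coeff_C_mul, coeff_mul_X', if_pos (by rw [Finsupp.mem_support_iff, Finsupp.single_eq_same]; omega),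
        single_succ_tsub_single_one, ih, pow_succ, mul_comm]
    · intro i _ hi
      rw [mul_left_comm, coeff_C_mul, coeff_mul_X', if_neg (by rw [Finsupp.mem_support_iff, not_not]; exact Finsupp.single_eq_of_ne hi),
        mul_zero]
    · intro h; exact absurd (Finset.mem_univ _) h

omit [DecidableEq K] in
/-- The coefficient of `u^{s + γe_k}` in the cone `r·u^s·(Σ cᵢuᵢ)^γ` is `r·c_k^γ`. [folklore] -/
theorem coeff_monomial_mul_linear_pow (s : Fin 3 →₀ ℕ) (r : K) (c : Fin 3 → K) (k : Fin 3) (γ : ℕ) :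
    coeff (s + Finsupp.single k γ) (monomial s r * (∑ i, C (c i) * X i) ^ γ) = r * c k ^ γ := by
  rw [coeff_monomial_mul', if_pos le_self_add, add_tsub_cancel_left, coeff_single_linear_pow]

omit [DecidableEq K] in
/-- The side condition under which a line `Σ cᵢuᵢ` in a minimiser's cone constrains the direction: the functional has
TWO nonzero coefficients, OR one nonzero coefficient at an OLD letter (outside `young`).  Its failure for a nonzero
functional = a single YOUNG letter: the cone is then a young monomial times `u_m^γ` with `m` young (no constraint). -/
def TwoOrOld (c : Fin 3 → K) (Y : Finset (Fin 3)) : Prop :=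
  (∃ k k', k ≠ k' ∧ c k ≠ 0 ∧ c k' ≠ 0) ∨ (∃ k, c k ≠ 0 ∧ k ∉ Y)

/-- **LINE SHAPE** of the minimiser `J₀` at time `t`: `J₀` is a `μ_P`-minimiser whose tangent cone is
`r·u^s·(Σ cᵢuᵢ)^γ`
with `r ≠ 0`, `γ > 0` (order `|s| + γ`). [new object] -/
def LineShape (W : ForcedWalk q s₀) (t : ℕ) (J₀ : Fin 3 →₀ ℕ) (s : Fin 3 →₀ ℕ) (r : K) (c : Fin 3 → K) (γ : ℕ) : Prop :=
  J₀ ∈ (ifp W t).idx ∧ (ifp W t).muP q = levelRatio (ordZero ((ifp W t).gen J₀)) (q - J₀.degree) ∧ r ≠ 0 ∧ 0 < γ ∧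
    ordZero ((ifp W t).gen J₀) = ((s.degree + γ : ℕ) : ℕ∞) ∧
    homogeneousComponent (s.degree + γ) ((ifp W t).gen J₀) = monomial s r * (∑ i, C (c i) * X i) ^ γ

/-- **THE LINE STEP (general carried line).**  At a stalled move of a root walk that is clean for the minimisers, a
minimiser in LINE SHAPE `r·u^s·H^γ`, `H = Σcᵢuᵢ`, with the two-or-old side condition, (i) moves ON THE PLANE
`{H = 0}` (`Σ cᵢδᵢ = 0`, the on-plane law), (ii) keeps a nonzero CARRIED functional `c[j ↦ 0]`, and (iii) is at `t+1`
again a minimiser in line shape `r'·u^{s'}·(Σ c[j↦0]ᵢuᵢ)^γ` with THE SAME `γ` (the carry law + stall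
rigidity). [new] [folklore] -/
theorem line_step {p e : ℕ} (hp : p.Prime) [CharP K p] {s₀ : State (Fin 3) K} (hs : IsRoot (p ^ e) s₀)
    (W : ForcedWalk (p ^ e) s₀) (t : ℕ)
    (hst : (ifp W (t + 1)).muTilde (p ^ e) = (ifp W t).muTilde (p ^ e)) (hcl : CleanAt W t)
    {J₀ : Fin 3 →₀ ℕ} {s : Fin 3 →₀ ℕ} {r : K} {c : Fin 3 → K} {γ : ℕ}
    (hL : LineShape W t J₀ s r c γ) (h2 : TwoOrOld c (ifp W t).young) :
    ∑ i, c i * direction W t i = 0 ∧ (∃ i, Function.update c (W.j t) 0 i ≠ 0) ∧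
      ∃ (s' : Fin 3 →₀ ℕ) (r' : K), LineShape W (t + 1) J₀ s' r' (Function.update c (W.j t) 0) γ := by
  classical
  obtain ⟨hJ₀, hμ, hr, hγ, hd₀, hG⟩ := hL
  have hgne : (ifp W t).gen J₀ ≠ 0 := by
    intro h0; rw [h0, ordZero_zero] at hd₀; exact ENat.top_ne_coe _ hd₀
  have hsupp : ∀ k, c k ≠ 0 → s + Finsupp.single k γ ∈ ((ifp W t).gen J₀).support := by
    intro k hk
    refine mem_support_of_mem_support_homogeneousComponent (d := s.degree + γ) ?_
    rw [mem_support_iff, hG, coeff_monomial_mul_linear_pow]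
    exact mul_ne_zero hr (pow_ne_zero _ hk)
  have hc0 : ∃ k, c k ≠ 0 := by
    rcases h2 with ⟨k, k', _, hk, _⟩ | ⟨k, hk, _⟩ <;> exact ⟨k, hk⟩
  -- the young letters of `s` dominate the divisor orders of the lost young walls (two-or-old)
  have hdiv : ∀ i ∈ (ifp W t).young, (i = W.j t ∨ W.b t i ≠ 0) →
      divisorOrder i ((ifp W t).gen J₀) ≤ ((s i : ℕ) : ℕ∞) := by
    intro i hi _
    obtain ⟨k, hk, hki⟩ : ∃ k, c k ≠ 0 ∧ k ≠ i := by
      rcases h2 with ⟨k, k', hkk', hk, hk'⟩ | ⟨k, hk, hky⟩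
      · by_cases hki : k = i
        · exact ⟨k', hk', fun h => hkk' (hki.trans h.symm)⟩
        · exact ⟨k, hk, hki⟩
      · exact ⟨k, hk, fun h => hky (h ▸ hi)⟩
    have h1 := divisorOrder_le_exponent (i := i) (hsupp k hk)
    rwa [Finsupp.add_apply, Finsupp.single_eq_of_ne (Ne.symm hki), add_zero] at h1
  -- (i) on-plane
  have hV : VertexLawAt W t := vertexLawAt_of_stall hp hs W t hst.symm.le
  have hon := eval_direction_eq_zero_of_vertexLawAt W t hV hJ₀ hμ s hr c hγ hd₀ hG hdiv
  -- (ii) the carried functional is nonzero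
  have hcb : ∃ i, Function.update c (W.j t) 0 i ≠ 0 := by
    by_contra hall
    push Not at hall
    have hc' : ∀ i, i ≠ W.j t → c i = 0 := fun i hi => by
      have := hall i; rwa [Function.update_of_ne hi] at this
    have hj : c (W.j t) = 0 := by
      rw [Finset.sum_eq_single (W.j t) (fun i _ hi => by rw [hc' i hi, zero_mul])
        (fun h => absurd (Finset.mem_univ _) h), direction_chart, mul_one] at hon
      exact hon
    obtain ⟨k, hk⟩ := hc0
    by_cases hkj : k = W.j t
    · exact hk (hkj ▸ hj)
    · exact hk (hc' k hkj)
  refine ⟨hon, hcb, ?_⟩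
  -- (iii) carry + rigidity
  have ha : p ^ e - J₀.degree ≤ s.degree + γ := by
    have := sing_ifp hp hs W t J₀ hJ₀ hgne
    rw [hd₀] at this; exact_mod_cast this
  have honb : ∑ i, c i * Function.update (W.b t) (W.j t) 1 i = 0 := hon
  have hcarry := carry_of_clean (W.b t) (W.onExc t) ha hd₀ s hr c γ hG honb hcb (hcl J₀ hJ₀ hμ _ hd₀)
  have hgen : (ifp W (t + 1)).gen J₀ =
      PointBlowup.translate (W.b t) (chartTransform (p ^ e - J₀.degree) (W.j t) ((ifp W t).gen J₀)) := by
    rw [ifp_succ]; rfl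
  have hrig := stall_rigid (p ^ e) (W.j t) (W.b t) (W.onExc t) (ifp W t) (fun J hJ => (level_bounds W t J hJ).2)
    (sing_ifp hp hs W t) (by rw [← ifp_succ]; exact hst.symm.le) hJ₀ hμ hd₀
  refine ⟨Finsupp.single (W.j t) (s.degree + γ - (p ^ e - J₀.degree)) +
        (s.erase (W.j t)).filter (fun i => W.b t i = 0),
      r * ∏ i ∈ univ.filter (fun i => W.b t i ≠ 0), W.b t i ^ ((s.erase (W.j t)) i),
      by rw [idx_ifp] at hJ₀ ⊢; exact hJ₀, by rw [ifp_succ]; exact hrig.2.2.1,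
      mul_ne_zero hr (Finset.prod_ne_zero_iff.mpr fun i hi => pow_ne_zero _ (Finset.mem_filter.mp hi).2), hγ, ?_, ?_⟩
  · rw [hgen, hcarry.1, map_add, Finsupp.degree_single]
    push_cast; ring
  · have hdeg : (Finsupp.single (W.j t) (s.degree + γ - (p ^ e - J₀.degree)) +
        (s.erase (W.j t)).filter (fun i => W.b t i = 0)).degree + γ =
        s.degree + γ - (p ^ e - J₀.degree) + (((s.erase (W.j t)).filter (fun i => W.b t i = 0)).degree + γ) := by
      rw [map_add, Finsupp.degree_single]; ring
    rw [hdeg, hgen, hcarry.2]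

/-- `carryLine` one step, as a function. [folklore] -/
theorem carryLine_succ (W : ForcedWalk q s₀) (s : ℕ) (c : Fin 3 → K) (n : ℕ) :
    carryLine W s c (n + 1) = Function.update (carryLine W s c n) (W.j (s + n)) 0 := rfl

/-- The third letter of `Fin 3`. [folklore] -/
theorem third_letter (j j' : Fin 3) (h : j ≠ j') : ∃ k : Fin 3, ∀ i : Fin 3, i ≠ j → i ≠ j' → i = k := by
  revert j j'; decide

/-- A `μ_P`-minimiser with a non-zero generator exists as soon as `μ_P < ∞` (some derivative is still carried).
[folklore] -/
theorem exists_minimiser (W : ForcedWalk q s₀) (t : ℕ) (h : (ifp W t).muP q ≠ ⊤) :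
    ∃ J₀ ∈ (ifp W t).idx, (ifp W t).muP q = levelRatio (ordZero ((ifp W t).gen J₀)) (q - J₀.degree) ∧
      (ifp W t).gen J₀ ≠ 0 := by
  classical
  have hne : (ifp W t).idx.Nonempty := by
    rw [Finset.nonempty_iff_ne_empty]
    intro h0; exact h (IFPState.muP_of_idx_empty q _ h0)
  obtain ⟨J₀, hJ₀, heq⟩ := Finset.exists_mem_eq_inf (ifp W t).idx hne
    (fun J => levelRatio (ordZero ((ifp W t).gen J)) (q - J.degree))
  refine ⟨J₀, hJ₀, heq, fun h0 => h ?_⟩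
  show (ifp W t).idx.inf (fun J => levelRatio (ordZero ((ifp W t).gen J)) (q - J.degree)) = ⊤
  rw [heq, h0, ordZero_zero, levelRatio_top]

/-- `μ_P < ∞` persists along the walk from a root (a non-zero carried derivative stays non-zero: its level is at most
its order (`Sing`), so neither the chart transform nor the translation kills it). [folklore] -/
theorem muP_ne_top_succ {p e : ℕ} (hp : p.Prime) [CharP K p] {s₀ : State (Fin 3) K} (hs : IsRoot (p ^ e) s₀)
    (W : ForcedWalk (p ^ e) s₀) (t : ℕ) (h : (ifp W t).muP (p ^ e) ≠ ⊤) : (ifp W (t + 1)).muP (p ^ e) ≠ ⊤ := by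
  classical
  obtain ⟨J₀, hJ₀, -, hne⟩ := exists_minimiser W t h
  have hgen : (ifp W (t + 1)).gen J₀ =
      PointBlowup.translate (W.b t) (chartTransform (p ^ e - J₀.degree) (W.j t) ((ifp W t).gen J₀)) := by
    rw [ifp_succ]; rfl
  have hne' : (ifp W (t + 1)).gen J₀ ≠ 0 := by
    rw [hgen]
    refine translate_ne_zero (W.b t) (chartTransform_ne_zero (p ^ e - J₀.degree) (W.j t) hne fun d hd => ?_)
    have h1 := sing_ifp hp hs W t J₀ hJ₀ hne
    have h2 : ordZero ((ifp W t).gen J₀) ≤ (d.degree : ℕ∞) :=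
      not_lt.mp fun hlt => (mem_support_iff.mp hd) (coeff_eq_zero_of_degree_lt_ordZero hlt)
    exact_mod_cast h1.trans h2
  obtain ⟨n, hn⟩ := exists_ordZero_eq_natCast hne'
  have hJ₁ : J₀ ∈ (ifp W (t + 1)).idx := by rw [idx_ifp] at hJ₀ ⊢; exact hJ₀
  intro htop
  have hle : (ifp W (t + 1)).muP (p ^ e) ≤ levelRatio (ordZero ((ifp W (t + 1)).gen J₀)) (p ^ e - J₀.degree) :=
    Finset.inf_le hJ₁
  rw [htop, hn, levelRatio_natCast, top_le_iff] at hle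
  exact WithTop.coe_ne_top hle

/-- `μ_P < ∞` persists: from time `N₁` to every later time. [folklore] -/
theorem muP_ne_top_of_le {p e : ℕ} (hp : p.Prime) [CharP K p] {s₀ : State (Fin 3) K} (hs : IsRoot (p ^ e) s₀)
    (W : ForcedWalk (p ^ e) s₀) {N₁ t : ℕ} (h : (ifp W N₁).muP (p ^ e) ≠ ⊤) (ht : N₁ ≤ t) :
    (ifp W t).muP (p ^ e) ≠ ⊤ := by
  obtain ⟨n, rfl⟩ := Nat.exists_eq_add_of_le ht
  clear ht
  induction n with
  | zero => exact h
  | succ n ih => exact muP_ne_top_succ hp hs W (N₁ + n) ih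

/-! ### §3g THE TURN LAW: two clean moves with a chart change make the minimiser's cone a MONOMIAL -/

set_option maxHeartbeats 1600000 in
/-- **THE TURN LAW.**  Let `t` and `t + 1` be stalled moves of a root walk that are clean for the minimisers, with a
CHART CHANGE `W.j (t+1) ≠ W.j t`, and let `J₀` be a `μ_P`-minimiser at `t` with `gen J₀ ≠ 0`.  Then at `t + 2` the
minimiser `J₀` (it persists, by stall rigidity) has a MONOMIAL tangent cone `ρ·u^S`.  Mechanism (kernel algebra): after
the clean move in chart `j` the cone is `u_j^{c}·H` with `H` free of `u_j` (two letters); the clean move in chart `j' ≠ j`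
reads `H` at `u_{j'} ↦ 1` and translates — a ONE-LETTER polynomial, whose initial form is a monomial — and reads `u_j^c`
as `(u_j + b_j)^c`, a unit or `u_j^c`; clean transport multiplies by `u_{j'}^{d'−a}`.  ALL SHAPE INFORMATION OF THE
CONE DIES AT A CLEAN TURN. [new] [folklore] -/
theorem turn_monomial {p e : ℕ} (hp : p.Prime) [CharP K p] {s₀ : State (Fin 3) K} (hs : IsRoot (p ^ e) s₀)
    (W : ForcedWalk (p ^ e) s₀) (t : ℕ)
    (hst : (ifp W (t + 1)).muTilde (p ^ e) = (ifp W t).muTilde (p ^ e))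
    (hst' : (ifp W (t + 2)).muTilde (p ^ e) = (ifp W (t + 1)).muTilde (p ^ e))
    (hcl : CleanAt W t) (hcl' : CleanAt W (t + 1)) (hturn : W.j (t + 1) ≠ W.j t)
    {J₀ : Fin 3 →₀ ℕ} (hJ₀ : J₀ ∈ (ifp W t).idx)
    (hμ : (ifp W t).muP (p ^ e) = levelRatio (ordZero ((ifp W t).gen J₀)) (p ^ e - J₀.degree))
    (hgne : (ifp W t).gen J₀ ≠ 0) :
    J₀ ∈ (ifp W (t + 2)).idx ∧
    (ifp W (t + 2)).muP (p ^ e) = levelRatio (ordZero ((ifp W (t + 2)).gen J₀)) (p ^ e - J₀.degree) ∧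
    ∃ (S : Fin 3 →₀ ℕ) (ρ : K), ρ ≠ 0 ∧ ordZero ((ifp W (t + 2)).gen J₀) = ((S.degree : ℕ) : ℕ∞) ∧
      homogeneousComponent S.degree ((ifp W (t + 2)).gen J₀) = monomial S ρ := by
  classical
  rw [show t + 2 = t + 1 + 1 from rfl] at hst' ⊢
  -- the move `t`: clean transport of the minimiser `J₀`
  obtain ⟨d₀, hd₀⟩ := exists_ordZero_eq_natCast hgne
  have ha : p ^ e - J₀.degree ≤ d₀ := by
    have := sing_ifp hp hs W t J₀ hJ₀ hgne
    rw [hd₀] at this; exact_mod_cast this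
  have hDne : dirForm d₀ (W.j t) (W.b t) ((ifp W t).gen J₀) ≠ 0 := dirForm_ne_zero _ _ hd₀
  obtain ⟨n, hn⟩ := exists_ordZero_eq_natCast hDne
  obtain ⟨H, hH⟩ : ∃ H, H = homogeneousComponent n (dirForm d₀ (W.j t) (W.b t) ((ifp W t).gen J₀)) := ⟨_, rfl⟩
  have h1 := initialForm_succ_of_cleanAt W t hcl hJ₀ hμ hd₀ ha hn
  rw [← hH] at h1
  have hrig := stall_rigid (p ^ e) (W.j t) (W.b t) (W.onExc t) (ifp W t) (fun J hJ => (level_bounds W t J hJ).2)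
    (sing_ifp hp hs W t) (by rw [← ifp_succ]; exact hst.symm.le) hJ₀ hμ hd₀
  have hJ₁ : J₀ ∈ (ifp W (t + 1)).idx := by rw [idx_ifp] at hJ₀ ⊢; exact hJ₀
  have hμ₁ : (ifp W (t + 1)).muP (p ^ e) =
      levelRatio (ordZero ((ifp W (t + 1)).gen J₀)) (p ^ e - J₀.degree) := by
    rw [ifp_succ]; exact hrig.2.2.1
  have hd₁ : ordZero ((ifp W (t + 1)).gen J₀) = ((d₀ - (p ^ e - J₀.degree) + n : ℕ) : ℕ∞) := h1.1
  have hgne₁ : (ifp W (t + 1)).gen J₀ ≠ 0 := by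
    intro h0; rw [h0, ordZero_zero] at hd₁; exact ENat.top_ne_coe _ hd₁
  have ha₁ : p ^ e - J₀.degree ≤ d₀ - (p ^ e - J₀.degree) + n := by
    have := sing_ifp hp hs W (t + 1) J₀ hJ₁ hgne₁
    rw [hd₁] at this; exact_mod_cast this
  -- the move `t + 1`: its direction form is `(u_j + b_j)^c · Q` with `Q` a ONE-LETTER polynomial
  have hDne₁ : dirForm (d₀ - (p ^ e - J₀.degree) + n) (W.j (t + 1)) (W.b (t + 1)) ((ifp W (t + 1)).gen J₀) ≠ 0 :=
    dirForm_ne_zero _ _ hd₁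
  obtain ⟨n₁, hn₁⟩ := exists_ordZero_eq_natCast hDne₁
  have h2 := initialForm_succ_of_cleanAt W (t + 1) hcl' hJ₁ hμ₁ hd₁ ha₁ hn₁
  have hrig₁ := stall_rigid (p ^ e) (W.j (t + 1)) (W.b (t + 1)) (W.onExc (t + 1)) (ifp W (t + 1))
    (fun J hJ => (level_bounds W (t + 1) J hJ).2) (sing_ifp hp hs W (t + 1)) (by rw [← ifp_succ]; exact hst'.symm.le)
    hJ₁ hμ₁ hd₁
  obtain ⟨Q, hQ⟩ : ∃ Q, Q = dehom (W.j (t + 1)) (W.b (t + 1)) H := ⟨_, rfl⟩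
  have hdir : dirForm (d₀ - (p ^ e - J₀.degree) + n) (W.j (t + 1)) (W.b (t + 1)) ((ifp W (t + 1)).gen J₀) =
      (X (W.j t) + C (W.b (t + 1) (W.j t))) ^ (d₀ - (p ^ e - J₀.degree)) * Q := by
    rw [dirForm_eq_dehom, h1.2, dehom_mul, dehom_pow, dehom_X_of_ne hturn.symm, hQ]
  obtain ⟨k, hk⟩ := third_letter (W.j t) (W.j (t + 1)) hturn.symm
  have hQvars : Q.vars ⊆ {k} := by
    intro i hi
    rw [hQ] at hi
    have h3 := Finset.mem_erase.mp (vars_dehom_subset _ _ _ hi)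
    have h4 := vars_homogeneousComponent_subset _ _ (hH ▸ h3.2 :
      i ∈ (homogeneousComponent n (dirForm d₀ (W.j t) (W.b t) ((ifp W t).gen J₀))).vars)
    rw [dirForm_eq_dehom] at h4
    have h5 := Finset.mem_erase.mp (vars_dehom_subset _ _ _ h4)
    exact Finset.mem_singleton.mpr (hk i h5.1 h3.1)
  have hQne : Q ≠ 0 := by
    intro h0; apply hDne₁; rw [hdir, h0, mul_zero]
  obtain ⟨m, hm⟩ := exists_ordZero_eq_natCast hQne
  have hQin := homogeneousComponent_eq_monomial_of_vars_subset hQvars hm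
  -- the initial form of the direction form at `t + 1` is a monomial (two cases on the translation of `u_j`)
  have hmono : ∃ (S : Fin 3 →₀ ℕ) (ρ : K), ρ ≠ 0 ∧
      homogeneousComponent n₁ (dirForm (d₀ - (p ^ e - J₀.degree) + n) (W.j (t + 1)) (W.b (t + 1))
        ((ifp W (t + 1)).gen J₀)) = monomial S ρ := by
    by_cases hβ : W.b (t + 1) (W.j t) = 0
    · have hV : ((X (W.j t) + C (W.b (t + 1) (W.j t))) ^ (d₀ - (p ^ e - J₀.degree)) : MvPolynomial (Fin 3) K) =
          X (W.j t) ^ (d₀ - (p ^ e - J₀.degree)) := by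
        rw [hβ, C_0, add_zero]
      have hord : ordZero (dirForm (d₀ - (p ^ e - J₀.degree) + n) (W.j (t + 1)) (W.b (t + 1))
          ((ifp W (t + 1)).gen J₀)) = ((d₀ - (p ^ e - J₀.degree) + m : ℕ) : ℕ∞) := by
        rw [hdir, hV, ordZero_mul, hm, X_pow_eq_monomial, ordZero_monomial _ (one_ne_zero' K),
          Finsupp.degree_single, Nat.cast_add]
      have hn₁eq : n₁ = d₀ - (p ^ e - J₀.degree) + m := by
        rw [hn₁] at hord; exact_mod_cast hord
      refine ⟨Finsupp.single (W.j t) (d₀ - (p ^ e - J₀.degree)) + Finsupp.single k m,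
        coeff (Finsupp.single k m) Q, hQin.2, ?_⟩
      rw [hn₁eq, hdir, hV, homogeneousComponent_mul_of_isHomogeneous' (isHomogeneous_X_pow _ _) Q m, hQin.1,
        X_pow_eq_monomial, monomial_mul, one_mul]
    · have hc0 : constantCoeff (((X (W.j t) + C (W.b (t + 1) (W.j t))) ^ (d₀ - (p ^ e - J₀.degree)) :
          MvPolynomial (Fin 3) K)) = W.b (t + 1) (W.j t) ^ (d₀ - (p ^ e - J₀.degree)) := by
        rw [map_pow, map_add, constantCoeff_X, constantCoeff_C, zero_add]
      have hV0 : ordZero (((X (W.j t) + C (W.b (t + 1) (W.j t))) ^ (d₀ - (p ^ e - J₀.degree)) :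
          MvPolynomial (Fin 3) K)) = 0 := by
        rw [ordZero_eq_zero_iff, hc0]; exact pow_ne_zero _ hβ
      have hord : ordZero (dirForm (d₀ - (p ^ e - J₀.degree) + n) (W.j (t + 1)) (W.b (t + 1))
          ((ifp W (t + 1)).gen J₀)) = (m : ℕ∞) := by
        rw [hdir, ordZero_mul, hV0, hm, zero_add]
      have hn₁eq : n₁ = m := by
        rw [hn₁] at hord; exact_mod_cast hord
      refine ⟨Finsupp.single k m, W.b (t + 1) (W.j t) ^ (d₀ - (p ^ e - J₀.degree)) * coeff (Finsupp.single k m) Q,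
        mul_ne_zero (pow_ne_zero _ hβ) hQin.2, ?_⟩
      rw [hn₁eq, hdir, homogeneousComponent_mul_of_ordZero_eq _ _ hm, hc0, hQin.1, C_mul_monomial]
  obtain ⟨S, ρ, hρ, hSρ⟩ := hmono
  have hSdeg : S.degree = n₁ :=
    degree_eq_of_mem_support_homogeneousComponent (G := dirForm (d₀ - (p ^ e - J₀.degree) + n) (W.j (t + 1))
      (W.b (t + 1)) ((ifp W (t + 1)).gen J₀)) (by
        rw [hSρ, support_monomial, if_neg hρ]; exact Finset.mem_singleton_self _)
  -- the move `t + 1`: clean transport turns the monomial initial form into the monomial cone at `t + 2`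
  refine ⟨by rw [idx_ifp] at hJ₀ ⊢; exact hJ₀, by rw [ifp_succ]; exact hrig₁.2.2.1,
    Finsupp.single (W.j (t + 1)) (d₀ - (p ^ e - J₀.degree) + n - (p ^ e - J₀.degree)) + S, ρ, hρ, ?_, ?_⟩
  · rw [map_add, Finsupp.degree_single, hSdeg]; exact h2.1
  · rw [map_add, Finsupp.degree_single, hSdeg, h2.2, hSρ, X_pow_eq_monomial, monomial_mul, one_mul]

end Walk

end Summit.ResolutionOfSingularities.ResolutionOfSingularities.Theorems.StallVertex
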